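/-
Copyright: statement-level skeleton of a published paper (lit-balaban cell, Phase-2 proof seat p32 gen 46). No claims beyond
what the kernel checks below.
-/
import Literature.MathematicalPhysics.QuantumFieldTheory.Balaban1983to89.B3GraphFiniteOrder
import Literature.MathematicalPhysics.QuantumFieldTheory.Balaban1983to89.B3GraphRelabelling

/-!
# B3 — T. Bałaban, *(Higgs)₂,₃ quantum fields in a finite volume. III. Renormalization*, CMP **88** (1983) 411–445
[Balaban1983Higgs3] — p. 415 [PDF 5] (1.17) «graph … in the usual sense» / p. 416 [PDF 6] (1.19)–(1.22) «combinatoric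
factors … are a part of the graphical description» / p. 420 [PDF 10] d_s(G), d_v(G) / p. 428 [PDF 18] (2.15): THE WEIGHTED
CLASS FORMULA — a sum of an isomorphism-invariant quantity over the graphs of the model with `V` LABELLED vertices is the
sum over the ISOMORPHISM CLASSES (graphs *"in the usual sense"*) weighted by `V!/|Aut|`; equivalently (in a field)
`Σ_classes f(c)/|Aut c| = (1/V!)·Σ_labelled f(G)` — the symmetry-factor identity behind the combinatoric factors print
leaves unwritten; the same restricted to the isomorphism-closed families print sums over (connected, one-particle
irreducible, proper, fixed orders, fixed number of external legs) and for the two-leg insertions of (1.21); FILE 2's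
conditional class formula / Burnside made unconditional by FILE 1's finiteness; at a fixed coupling order only boundedly
many vertex numbers carry connected graphs

statement-level skeleton of published theorems with citation tags; proofs where landed; nothing here is a claim about
the Yang–Mills mass gap

PDF held: `paper:balaban1983-higgs-2-3-quantum-fields-finite-volume` (journal page = PDF page + 410); pp. 415, 416, 420
read as images on the ×2 renders `run/shared/lean/pub/pub-balaban/b2b-balaban-ref1/pages/1983-cmp88-higgs23-III/
1983-cmp88-higgs23-III-p005-x2.png` / `…-p006-x2.png` / `…-p010-x2.png`.

CITATION HEADER (lean-in-tree rule).  lit-balaban TYPED SKELETON (HOME `run/shared/lean/pub/lit-balaban/`), PHASE 2, seat p32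
gen 46 (unit `lit-balaban-p32`; TAKING line HOME/STATUS.md 2026-08-24T16:30:00Z, free-target protocol G.5-34(d)), rows
**B3.Eq1.17-1.18** («graph», p. 415) and **B3.Eq1.19-1.22** ((1.21)–(1.22), p. 416) of `HOME/lit-balaban-r15/ROWS-B3.md` (fold
owner r15; both heads `proved`; this file is an OPTIONAL located member, zero head weight).  FILE C of the item «finiteness
and relabelling at fixed order»: FILE 1 = `B3GraphFiniteOrder` (finitely many labelled graphs / insertions with `V`
vertices; order bound for connected graphs), FILE 2 = `B3GraphRelabelling` (relabelling action, orbits = isomorphism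
classes, orbit–stabilizer, class formula and Burnside under a finiteness hypothesis) — both imported here.  CONSUMES BY NAME:
p18's model `B3Cor23Concrete.Graph` (p. 415), p37's `B3OnePIChainGlue.TwoLegGraph` ((1.21)) and `B3OnePIGraphs.IsConnected` /
`IsOnePI` / `IsProper`, p33's `B3ClassOrders420.orders` / `dsG` / `dvG` / `ordersCt` / `orders_eq_of_relabel` (p. 420), p32's
`B3GraphIso.GraphIso` / `TwoLegGraphIso` (+ `isConnected_iff`, `isOnePI_iff`, `isProper_iff`, `numExtLegs_eq`, `kind_eq`,
`kind_eq_symm`), FILE 1's `finite_graph_nV_eq` / `finite_twoLeg_nV_eq` / `nV_le_of_isConnected`, FILE 2's `GraphOn` /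
`permMulAction` / `mem_orbit_iff_nonempty_graphIso` / `orbit_eq_setOf_iso` / `ncard_iso_eq_factorial_div` /
`card_aut_dvd_factorial` / `IsoClassOn` / `finite_isoClassOn` / `card_graphOn_eq_finsum_classes` /
`card_isoClassOn_mul_factorial` and their two-leg twins; Mathlib's `MulAction.selfEquivSigmaOrbits`,
`MulAction.index_stabilizer`, `finsum`.  Nothing re-declared; no declaration is added to another file's namespace.

THE PRINTED TEXT (verbatim).  p. 415: *"Now a graph for us is a collection of internal lines, external legs, and vertices
connected in the usual sense. There is at least one internal line, and every internal line has a vertex at each endpoint.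
The construction of graphs is otherwise arbitrary."*  p. 416, after (1.22): *"Here we did not write, and we will not write
in the future, combinatoric factors before the graphs, understanding that they are a part of the graphical description."*
p. 416: *"Σ^ε, Σ^ε_1, Σ^ε_2 are given by amputated, one-particle-irreducible graphs of the expansion of G^ε."*  p. 420:
*"Let us denote by d_s(v) an order of the coupling constant λ for the vertex v, and by d_v(v) an order of the coupling
constant e. Finally let d_s(G) = Σ_{v∈G} d_s(v), d_v(G) = Σ_{v∈G} d_v(v)."*  p. 428, (2.15): the sum *"Σ_{proper
graphs G}"*.

KIND «(ours)» (G.5-54): print states none of this; it sums "over graphs" taken *"in the usual sense"* (up to isomorphism)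
with the combinatoric factors understood, while p18's carrier labels the vertices `0, …, V−1`.  This file is the one
identity that converts between the two readings for ANY isomorphism-invariant summand (an amplitude, an indicator, a
constant): orbit regrouping under the relabelling action of FILE 2, with the orbit sizes `V!/|Aut|` of FILE 2's
orbit–stabilizer and the finiteness of FILE 1.  Each declaration's cite tag is a CONTEXT locator (the printed notion the
identity serves), not a transcription.

WHAT IS PROVED (theorems + two `instance`s; no `def`, no `Prop` fact, no `sorry`; standard axioms).
* `§1` (plumbing, any group action on a finite type) `selfEquivSigmaOrbits_apply_coe`; **`finsum_eq_finsum_card_orbit_smul`**: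
  `Σ_x f x = Σ_{classes c} |orbit c.out| • f c.out` for `f` constant on orbits; `apply_out_mk_eq`;
  **`finsum_comp_mk_eq_finsum_card_orbit_smul`** (class functions); `finsum_eq_finsum_index_stabilizer_smul`;
  `finsum_subtype_eq_finsum_ite`.
* `§2` graphs with `V` labelled vertices: **`finite_isoClassOn'`** (instance, unconditional), `apply_smul_eq_of_iso_invariant`
  / `eq_of_smul_invariant` (isomorphism-invariant ⇔ constant on relabelling orbits), `apply_out_mk_eq_graphOn`,
  **`finsum_graphOn_eq_finsum_classes`**: `∑ᶠ G, f G = ∑ᶠ c, (V!/|Aut c.out|) • f c.out`, **`finsum_graphOn_comp_mk`**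
  (class functions: `∑ᶠ G, g ⟦G⟧ = ∑ᶠ c, (V!/|Aut c|) • g c`), **`finsum_classes_div_card_aut`** (field form:
  `∑ᶠ c, f c.out/|Aut c.out| = (∑ᶠ G, f G)/V!`), `finsum_graphOn_ite_eq_finsum_classes` /
  **`finsum_subtype_graphOn_eq_finsum_classes`** (restriction to any isomorphism-closed family `P`).
* `§3` orders are class functions: **`orders_eq_of_graphIso`**, `dsG_eq_of_graphIso`, `dvG_eq_of_graphIso`, `orders_smul`,
  **`ordersCt_eq_of_graphIso`** (counterterm orders transported along the isomorphism), `ct_pos_of_graphIso`,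
  **`connectedOrderLe_iff_of_graphIso`** (FILE 1's fixed-order family is isomorphism-closed).
* `§4` the families print sums over: **`finsum_connected_eq_finsum_classes`**, **`finsum_onePI_eq_finsum_classes`**,
  `finsum_proper_eq_finsum_classes`, **`finsum_connected_orders_eq_finsum_classes`**, `finsum_numExtLegs_eq_finsum_classes`.
* `§5` two-leg insertions: **`finite_isoClassOnTL'`** (instance), `apply_smul_eq_of_iso_invariant_TL` /
  `eq_of_smul_invariant_TL`, `apply_out_mk_eq_twoLegOn`, **`finsum_twoLegOn_eq_finsum_classes`**, `finsum_twoLegOn_comp_mk`,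
  **`finsum_classesTL_div_card_aut`**,
  `finsum_twoLegOn_ite_eq_finsum_classes` / `finsum_subtype_twoLegOn_eq_finsum_classes`, **`finsum_onePI_TL_eq_finsum_classes`**
  (the 1PI letters of (1.21)), `finsum_connected_TL_eq_finsum_classes` (the chains).
* `§6` unconditional counts: `card_graphOn_eq_finsum_classes'`, `card_isoClassOn_mul_factorial'` (Burnside),
  `card_isoClassOn_le`,
  `card_twoLegOn_eq_finsum_classes'`, `card_isoClassOnTL_mul_factorial'`; bounded coupling order: **`not_exists_connected_of_lt`**
  (no connected graph of total order `≤ N` on `V > (n̄+5)·N` vertices), `finite_setOf_nV_connected_order_le`,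
  `isEmpty_classes_connected_of_lt`.

HONEST SCOPE.  (i) WHICH SYMMETRY GROUP.  `|Aut c|` is `Nat.card (GraphIso G G)` for a representative `G`, i.e. the
order of FILE 2's `autGroup`: the bijections `σ` of the vertex labels `Fin G.nV` that preserve the catalogue kind of every
vertex and whose INDUCED leg map (same slot index at the image vertex — `B3GraphIso.legOf`) carries the pairing `G.other`
to itself.  These are the automorphisms of p18's `Graph` STRUCTURE that are rigid on the legs: a permutation of the legs
inside one vertex (e.g. of the four φ′-legs of (1.6)), or of several lines joining the same two vertices, is NOT an
element unless induced by a vertex bijection, and is never counted separately.  Consequently `V!/|Aut c|` is exactly the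
number of distinct LABELLED structures in the class (orbit–stabilizer, FILE 2) — the vertex-relabelling part of a symmetry
factor — and in general NOT the textbook Feynman symmetry factor of the unwritten *"combinatoric factors"* of p. 416, which
also counts leg/line permutations and combines with the `1/n!` of the exponential series and the normalisations of the
vertices; for the letters of (1.21) the two marked external legs are moreover FIXED by `TwoLegGraphIso` (FILE 2:
`card_autTL_dvd_card_aut`).  Reading `V!/|Aut|` as "the combinatoric factor" is therefore a READING of p. 416 restricted
to vertex labels, labelled «(ours)»; print's full factors are not defined or derived here.  (ii) No amplitude is attached:
`f` is an arbitrary isomorphism-invariant summand; the invariance of the model's evaluator under isomorphisms is p37's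
`B3GraphIsoAmplitude.graphAmp_iso` / `kernel_pull` (not imported), whose data (kernels, localizations, external functions)
must be supplied functorially in the graph before it instantiates `f`.  (iii) The classes are read on Mathlib's chosen
representatives `c.out`; every weight and every summand is representative-independent by the invariance hypotheses
(`card_aut_eq_of_iso`, `hf`, `hP`).  (iv) `§6`'s bound is FILE 1's crude `(n̄+5)·N` under its provisos (connected, not all
of kind (1.13), counterterm orders positive at the vertices (1.7)); nothing sharper is claimed.  (v) Nothing analytic.
-/

namespace Literature.MathematicalPhysics.QuantumFieldTheory.Balaban1983to89.B3GraphClassCount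

open B3Prop1 B3Cor23Concrete B3GraphGlueLegs B3OnePIChainGlue B3OnePIGraphs B3GraphIso B3GraphRelabelling
  B3GraphFiniteOrder B3ClassOrders420

/-! ## §1 Orbit regrouping of an invariant sum (finite group action; plumbing) -/

section Orbit

variable {Γ : Type*} [Group Γ] {X : Type*} [MulAction Γ X] {M : Type*}

/-- kernel («(ours)», plumbing): Mathlib's orbit decomposition `X ≃ Σ c, orbit Γ c.out` sends a point to itself in the
fibre of its class. [cite: Balaban1983Higgs3, (1.21)–(1.22) p.416] -/
theorem selfEquivSigmaOrbits_apply_coe (x : X) : ((MulAction.selfEquivSigmaOrbits Γ X x).2 : X) = x := rfl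

/-- **ORBIT REGROUPING OF AN INVARIANT SUM** («(ours)», plumbing; the finite-group-action identity behind every passage
from labelled to unlabelled graphs): for a group `Γ` acting on a finite type `X` and a function `f` constant on the orbits,
`Σ_x f x = Σ_{classes c} |orbit c| • f c` (the class read on the representative `c.out`).
[cite: Balaban1983Higgs3, (1.21)–(1.22) p.416] -/
theorem finsum_eq_finsum_card_orbit_smul [AddCommMonoid M] [Finite X] (f : X → M)
    (hf : ∀ (g : Γ) (x : X), f (g • x) = f x) :
    ∑ᶠ x, f x = ∑ᶠ c : MulAction.orbitRel.Quotient Γ X, Nat.card (MulAction.orbit Γ c.out) • f c.out := by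
  classical
  haveI : Fintype X := Fintype.ofFinite X
  haveI : Fintype (MulAction.orbitRel.Quotient Γ X) := Fintype.ofFinite _
  haveI : ∀ c : MulAction.orbitRel.Quotient Γ X, Fintype (MulAction.orbit Γ c.out) := fun _ => Fintype.ofFinite _
  rw [finsum_eq_sum_of_fintype, finsum_eq_sum_of_fintype]
  have h1 : ∑ x, f x = ∑ p : (Σ c : MulAction.orbitRel.Quotient Γ X, MulAction.orbit Γ c.out), f p.2.1 := by
    rw [← Equiv.sum_comp (MulAction.selfEquivSigmaOrbits Γ X) (fun p => f p.2.1)]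
    exact Finset.sum_congr rfl fun x _ => by rw [selfEquivSigmaOrbits_apply_coe]
  rw [h1, Fintype.sum_sigma]
  refine Finset.sum_congr rfl fun c _ => ?_
  have h2 : ∀ y : MulAction.orbit Γ c.out, f y.1 = f c.out := by
    rintro ⟨y, g, rfl⟩
    exact hf g c.out
  rw [Finset.sum_congr rfl fun y _ => h2 y, Finset.sum_const, Finset.card_univ, Nat.card_eq_fintype_card]

/-- kernel: a function constant on the orbits takes the same value on a point and on the chosen representative of its class.
[cite: Balaban1983Higgs3, (1.21)–(1.22) p.416] -/
theorem apply_out_mk_eq (f : X → M) (hf : ∀ (g : Γ) (x : X), f (g • x) = f x) (x : X) :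
    f (Quotient.mk (MulAction.orbitRel Γ X) x : MulAction.orbitRel.Quotient Γ X).out = f x := by
  obtain ⟨g, hg⟩ := MulAction.mem_orbit_iff.mp
    (MulAction.orbitRel.Quotient.mem_orbit.mpr (Quotient.out_eq (Quotient.mk (MulAction.orbitRel Γ X) x)) :
      (Quotient.mk (MulAction.orbitRel Γ X) x : MulAction.orbitRel.Quotient Γ X).out ∈
        MulAction.orbitRel.Quotient.orbit (Quotient.mk (MulAction.orbitRel Γ X) x : MulAction.orbitRel.Quotient Γ X))
  rw [← hg, hf]

/-- **Orbit regrouping for a CLASS FUNCTION** («(ours)», plumbing): summing `g(class of x)` over the points counts every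
class `|orbit|` times. [cite: Balaban1983Higgs3, (1.21)–(1.22) p.416] -/
theorem finsum_comp_mk_eq_finsum_card_orbit_smul [AddCommMonoid M] [Finite X] (g : MulAction.orbitRel.Quotient Γ X → M) :
    ∑ᶠ x, g (Quotient.mk (MulAction.orbitRel Γ X) x) =
      ∑ᶠ c : MulAction.orbitRel.Quotient Γ X, Nat.card (MulAction.orbit Γ c.out) • g c := by
  rw [finsum_eq_finsum_card_orbit_smul (fun x => g (Quotient.mk (MulAction.orbitRel Γ X) x)) fun γ x =>
    congrArg g (Quotient.sound (MulAction.mem_orbit x γ))]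
  exact finsum_congr fun c => by rw [Quotient.out_eq]

/-- kernel: the orbit sizes in the regrouping are the indices of the stabilizers (orbit–stabilizer).
[cite: Balaban1983Higgs3, (1.21)–(1.22) p.416] -/
theorem finsum_eq_finsum_index_stabilizer_smul [AddCommMonoid M] [Finite X] (f : X → M)
    (hf : ∀ (g : Γ) (x : X), f (g • x) = f x) :
    ∑ᶠ x, f x = ∑ᶠ c : MulAction.orbitRel.Quotient Γ X, (MulAction.stabilizer Γ c.out).index • f c.out := by
  rw [finsum_eq_finsum_card_orbit_smul f hf]
  exact finsum_congr fun c => by rw [MulAction.index_stabilizer, Nat.card_coe_set_eq]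

end Orbit

/-! ## §2 The weighted class formula for the graphs of the model -/

section Graphs

variable {nbar V : ℕ} {M : Type*}

/-- **Finitely many isomorphism classes of graphs of the model on `V` vertices** — UNCONDITIONAL: FILE 2's
`finite_isoClassOn` with its `[Finite {G // G.nV = V}]` hypothesis discharged by FILE 1's `finite_graph_nV_eq`.
[cite: Balaban1983Higgs3, p.415] -/
instance finite_isoClassOn' (nbar V : ℕ) : Finite (IsoClassOn nbar V) :=
  finite_isoClassOn nbar V

/-- kernel: an ISOMORPHISM-INVARIANT function on the labelled graphs with `V` vertices is constant on the orbits of the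
relabelling action. [cite: Balaban1983Higgs3, p.415] -/
theorem apply_smul_eq_of_iso_invariant (f : GraphOn nbar V → M)
    (hf : ∀ G H : GraphOn nbar V, Nonempty (GraphIso G.1 H.1) → f G = f H) (σ : Equiv.Perm (Fin V))
    (G : GraphOn nbar V) : f (σ • G) = f G :=
  hf _ _ (mem_orbit_iff_nonempty_graphIso.mp (MulAction.mem_orbit G σ))

/-- kernel: conversely a function constant on the orbits of the relabelling action is an isomorphism invariant.
[cite: Balaban1983Higgs3, p.415] -/
theorem eq_of_smul_invariant (f : GraphOn nbar V → M)
    (hf : ∀ (σ : Equiv.Perm (Fin V)) (G : GraphOn nbar V), f (σ • G) = f G)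
    {G H : GraphOn nbar V} (e : GraphIso G.1 H.1) : f G = f H := by
  obtain ⟨σ, hσ⟩ := MulAction.mem_orbit_iff.mp (mem_orbit_iff_nonempty_graphIso.mpr ⟨e⟩)
  rw [← hσ, hf]

/-- kernel: an isomorphism-invariant `f` takes the same value on a labelled graph and on the chosen representative of its
class (so the class-side summands below do not depend on Mathlib's choice `c.out`). [cite: Balaban1983Higgs3, p.415] -/
theorem apply_out_mk_eq_graphOn (f : GraphOn nbar V → M)
    (hf : ∀ G H : GraphOn nbar V, Nonempty (GraphIso G.1 H.1) → f G = f H) (G : GraphOn nbar V) :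
    f (Quotient.mk (MulAction.orbitRel (Equiv.Perm (Fin V)) (GraphOn nbar V)) G : IsoClassOn nbar V).out = f G :=
  apply_out_mk_eq f (apply_smul_eq_of_iso_invariant f hf) G

/-- **THE WEIGHTED CLASS FORMULA** («(ours)»; the dictionary that print's unwritten *"combinatoric factors … are a part of
the graphical description"* (p. 416) relies on, at the level of vertex labels): for every isomorphism-invariant function `f`
on the graphs of the model with the `V` labelled vertices, `Σ_{G} f G = Σ_{classes c} (V!/|Aut c|) • f c` — each graph
*"in the usual sense"* (p. 415) is met `V!/|Aut|` times among the labelled ones (FILE 2's orbit–stabilizer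
`ncard_iso_mul_card_aut`; the sum is unconditional by FILE 1's `finite_graph_nV_eq`).
[cite: Balaban1983Higgs3, p.415, (1.21)–(1.22) p.416] -/
theorem finsum_graphOn_eq_finsum_classes [AddCommMonoid M] (f : GraphOn nbar V → M)
    (hf : ∀ G H : GraphOn nbar V, Nonempty (GraphIso G.1 H.1) → f G = f H) :
    ∑ᶠ G : GraphOn nbar V, f G =
      ∑ᶠ c : IsoClassOn nbar V, (V.factorial / Nat.card (GraphIso c.out.1 c.out.1)) • f c.out := by
  rw [finsum_eq_finsum_card_orbit_smul f (apply_smul_eq_of_iso_invariant f hf)]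
  refine finsum_congr fun c => ?_
  rw [Nat.card_coe_set_eq, orbit_eq_setOf_iso, ncard_iso_eq_factorial_div]

/-- **The weighted class formula for a CLASS FUNCTION**: summing `g(class of G)` over the labelled graphs with `V`
vertices counts the class `c` exactly `V!/|Aut c|` times. [cite: Balaban1983Higgs3, p.415, (1.21)–(1.22) p.416] -/
theorem finsum_graphOn_comp_mk [AddCommMonoid M] (g : IsoClassOn nbar V → M) :
    ∑ᶠ G : GraphOn nbar V, g (Quotient.mk (MulAction.orbitRel (Equiv.Perm (Fin V)) (GraphOn nbar V)) G) =
      ∑ᶠ c : IsoClassOn nbar V, (V.factorial / Nat.card (GraphIso c.out.1 c.out.1)) • g c := by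
  rw [finsum_comp_mk_eq_finsum_card_orbit_smul]
  refine finsum_congr fun c => ?_
  rw [Nat.card_coe_set_eq, orbit_eq_setOf_iso, ncard_iso_eq_factorial_div]

/-- **THE SYMMETRY-FACTOR IDENTITY** (field form of the weighted class formula): for an isomorphism-invariant `f` with
values in a field of characteristic zero, `Σ_{classes c} f(c)/|Aut c| = (1/V!) · Σ_{labelled G} f(G)` — the weight
`1/|Aut G|` of an unlabelled graph is the labelled average.  `|Aut|` = the order of FILE 2's `autGroup` (kind-preserving
vertex bijections whose induced leg map preserves the pairing; rigid on leg slots): the VERTEX-RELABELLING PART of a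
symmetry factor — a READING of p. 416's unwritten factors restricted to vertex labels («(ours)»), not the textbook Feynman
factor (leg/line permutations, `1/n!`, vertex normalisations are not modelled).
[cite: Balaban1983Higgs3, (1.21)–(1.22) p.416] -/
theorem finsum_classes_div_card_aut {K : Type*} [Field K] [CharZero K] (f : GraphOn nbar V → K)
    (hf : ∀ G H : GraphOn nbar V, Nonempty (GraphIso G.1 H.1) → f G = f H) :
    ∑ᶠ c : IsoClassOn nbar V, f c.out / (Nat.card (GraphIso c.out.1 c.out.1) : K) =
      (∑ᶠ G : GraphOn nbar V, f G) / (V.factorial : K) := by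
  classical
  haveI : Fintype (IsoClassOn nbar V) := Fintype.ofFinite _
  rw [finsum_graphOn_eq_finsum_classes f hf, finsum_eq_sum_of_fintype, finsum_eq_sum_of_fintype, Finset.sum_div]
  refine Finset.sum_congr rfl fun c _ => ?_
  have ha : (Nat.card (GraphIso c.out.1 c.out.1) : K) ≠ 0 := Nat.cast_ne_zero.mpr (card_graphIso_self_pos c.out.1).ne'
  have hV : (V.factorial : K) ≠ 0 := Nat.cast_ne_zero.mpr (Nat.factorial_ne_zero V)
  have hdvd : Nat.card (GraphIso c.out.1 c.out.1) ∣ V.factorial := by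
    have h := card_aut_dvd_factorial c.out.1
    rwa [c.out.2] at h
  rw [nsmul_eq_mul, Nat.cast_div_charZero hdvd]
  field_simp

/-- kernel («(ours)», plumbing): a sum over a subtype is the sum of the function cut off by the predicate.
[cite: Balaban1983Higgs3, (1.21)–(1.22) p.416] -/
theorem finsum_subtype_eq_finsum_ite [AddCommMonoid M] {α : Type*} (p : α → Prop) [DecidablePred p] (f : α → M) :
    ∑ᶠ j : Subtype p, f j.1 = ∑ᶠ i, if p i then f i else 0 :=
  (finsum_subtype_eq_finsum_cond (f := f) p).trans (finsum_congr fun _ => finsum_eq_if)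

/-- **The weighted class formula RESTRICTED TO AN ISOMORPHISM-CLOSED FAMILY of graphs** (the families print sums over —
connected graphs in (1.19)/(2.15), one-particle-irreducible ones in (1.21), proper ones in (2.15), graphs of given orders —
are closed under isomorphism), cut-off form: `Σ_G 1_P(G) f(G) = Σ_c 1_P(c) (V!/|Aut c|) • f(c)`.
[cite: Balaban1983Higgs3, (1.19)–(1.22) p.416, (2.15) p.428] -/
theorem finsum_graphOn_ite_eq_finsum_classes [AddCommMonoid M] (P : GraphOn nbar V → Prop) [DecidablePred P]
    (hP : ∀ G H : GraphOn nbar V, Nonempty (GraphIso G.1 H.1) → (P G ↔ P H)) (f : GraphOn nbar V → M)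
    (hf : ∀ G H : GraphOn nbar V, Nonempty (GraphIso G.1 H.1) → f G = f H) :
    ∑ᶠ G : GraphOn nbar V, (if P G then f G else 0) =
      ∑ᶠ c : IsoClassOn nbar V, if P c.out then (V.factorial / Nat.card (GraphIso c.out.1 c.out.1)) • f c.out else 0 := by
  rw [finsum_graphOn_eq_finsum_classes (fun G => if P G then f G else 0) fun G H h => by
    by_cases hG : P G
    · rw [if_pos hG, if_pos ((hP G H h).mp hG), hf G H h]
    · rw [if_neg hG, if_neg (mt (hP G H h).mpr hG)]]
  exact finsum_congr fun c => by split_ifs <;> simp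

/-- **The weighted class formula restricted to an isomorphism-closed family**, subtype form: the sum of an invariant `f`
over the labelled graphs with `V` vertices satisfying `P` is the sum over the CLASSES satisfying `P` of `(V!/|Aut c|) • f c`.
[cite: Balaban1983Higgs3, (1.19)–(1.22) p.416, (2.15) p.428] -/
theorem finsum_subtype_graphOn_eq_finsum_classes [AddCommMonoid M] (P : GraphOn nbar V → Prop)
    (hP : ∀ G H : GraphOn nbar V, Nonempty (GraphIso G.1 H.1) → (P G ↔ P H)) (f : GraphOn nbar V → M)
    (hf : ∀ G H : GraphOn nbar V, Nonempty (GraphIso G.1 H.1) → f G = f H) :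
    ∑ᶠ G : {G : GraphOn nbar V // P G}, f G.1 =
      ∑ᶠ c : {c : IsoClassOn nbar V // P c.out}, (V.factorial / Nat.card (GraphIso c.1.out.1 c.1.out.1)) • f c.1.out := by
  classical
  calc ∑ᶠ G : {G : GraphOn nbar V // P G}, f G.1
      = ∑ᶠ G : GraphOn nbar V, (if P G then f G else 0) := finsum_subtype_eq_finsum_ite P f
    _ = ∑ᶠ c : IsoClassOn nbar V, if P c.out then (V.factorial / Nat.card (GraphIso c.out.1 c.out.1)) • f c.out else 0 :=
        finsum_graphOn_ite_eq_finsum_classes P hP f hf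
    _ = ∑ᶠ c : {c : IsoClassOn nbar V // P c.out}, (V.factorial / Nat.card (GraphIso c.1.out.1 c.1.out.1)) • f c.1.out :=
        (finsum_subtype_eq_finsum_ite (fun c : IsoClassOn nbar V => P c.out)
          (fun c => (V.factorial / Nat.card (GraphIso c.out.1 c.out.1)) • f c.out)).symm

end Graphs

/-! ## §3 The coupling orders are class functions -/

section Orders

variable {nbar V : ℕ}

/-- **Isomorphic graphs have the same orders (d_s(G), d_v(G))** (p. 420: *"d_s(G) = Σ_{v∈G} d_s(v), d_v(G) = Σ_{v∈G}
d_v(v)"* depend on the vertex kinds only; p33's `orders_eq_of_relabel` along the kind-preserving vertex bijection of the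
isomorphism). [cite: Balaban1983Higgs3, p.420] -/
theorem orders_eq_of_graphIso {G H : Graph nbar} (e : GraphIso G H) : orders H = orders G :=
  orders_eq_of_relabel e.toEquiv e.kind_eq

/-- kernel: d_s is a class invariant. [cite: Balaban1983Higgs3, p.420] -/
theorem dsG_eq_of_graphIso {G H : Graph nbar} (e : GraphIso G H) : dsG H = dsG G :=
  congrArg Prod.fst (orders_eq_of_graphIso e)

/-- kernel: d_v is a class invariant. [cite: Balaban1983Higgs3, p.420] -/
theorem dvG_eq_of_graphIso {G H : Graph nbar} (e : GraphIso G H) : dvG H = dvG G :=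
  congrArg Prod.snd (orders_eq_of_graphIso e)

/-- kernel: relabelling the vertices does not change the orders. [cite: Balaban1983Higgs3, p.420] -/
theorem orders_smul (σ : Equiv.Perm (Fin V)) (G : GraphOn nbar V) : orders (σ • G).1 = orders G.1 :=
  (orders_eq_of_graphIso (isoRelabel G.1 (σ.symm.trans (finCongr G.2.symm)))).symm

/-- **The orders WITH THE COUNTERTERM ORDERS COUNTED are class functions too**: counterterm orders `ct` assigned to the
vertices of `G` (p33's `ordersCt`; a vertex (1.7) carries the orders of its counterterm's graph, p. 417) and transported
along an isomorphism `e : G ≅ H` give `H` the same total orders. [cite: Balaban1983Higgs3, p.417, p.420] -/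
theorem ordersCt_eq_of_graphIso {G H : Graph nbar} (e : GraphIso G H) (ct : Fin G.nV → ℕ × ℕ) :
    ordersCt H (fun w => ct (e.toEquiv.symm w)) = ordersCt G ct := by
  rw [ordersCt_eq, ordersCt_eq, dsG_eq_of_graphIso e, dvG_eq_of_graphIso e,
    Equiv.sum_comp e.toEquiv.symm (fun i => (ct i).1), Equiv.sum_comp e.toEquiv.symm (fun i => (ct i).2)]

/-- kernel: the proviso *"counterterms of positive order at every vertex (1.7)"* (δm² starts at order two, p. 417) is
transported along an isomorphism together with `ct`. [cite: Balaban1983Higgs3, p.417] -/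
theorem ct_pos_of_graphIso {G H : Graph nbar} (e : GraphIso G H) {ct : Fin G.nV → ℕ × ℕ}
    (hct : ∀ i, G.kind i = .v17 → 1 ≤ (ct i).1 + (ct i).2) (w : Fin H.nV) (hw : H.kind w = .v17) :
    1 ≤ (ct (e.toEquiv.symm w)).1 + (ct (e.toEquiv.symm w)).2 :=
  hct _ ((e.kind_eq_symm w).trans hw)

/-- **The family summed at a fixed coupling order is isomorphism-closed**: «connected, not made of operator vertices (1.13)
only, admitting counterterm orders of positive order at the vertices (1.7) with total order ≤ N» (the finite family of FILE
1's `finite_connected_ordersCt_le`) is a property of the isomorphism class.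
[cite: Balaban1983Higgs3, (1.17) p.415, p.417, p.420] -/
theorem connectedOrderLe_iff_of_graphIso {G H : Graph nbar} (e : GraphIso G H) (N : ℕ) :
    (IsConnected G ∧ (∃ j, G.kind j ≠ .v113) ∧ ∃ ct : Fin G.nV → ℕ × ℕ,
        (∀ i, G.kind i = .v17 → 1 ≤ (ct i).1 + (ct i).2) ∧ (ordersCt G ct).1 + (ordersCt G ct).2 ≤ N) ↔
      (IsConnected H ∧ (∃ j, H.kind j ≠ .v113) ∧ ∃ ct : Fin H.nV → ℕ × ℕ,
        (∀ i, H.kind i = .v17 → 1 ≤ (ct i).1 + (ct i).2) ∧ (ordersCt H ct).1 + (ordersCt H ct).2 ≤ N) := by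
  suffices key : ∀ {A B : Graph nbar} (e : GraphIso A B),
      (IsConnected A ∧ (∃ j, A.kind j ≠ .v113) ∧ ∃ ct : Fin A.nV → ℕ × ℕ,
        (∀ i, A.kind i = .v17 → 1 ≤ (ct i).1 + (ct i).2) ∧ (ordersCt A ct).1 + (ordersCt A ct).2 ≤ N) →
      (IsConnected B ∧ (∃ j, B.kind j ≠ .v113) ∧ ∃ ct : Fin B.nV → ℕ × ℕ,
        (∀ i, B.kind i = .v17 → 1 ≤ (ct i).1 + (ct i).2) ∧ (ordersCt B ct).1 + (ordersCt B ct).2 ≤ N) from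
    ⟨key e, key e.symm⟩
  intro A B e
  rintro ⟨hc, ⟨j, hj⟩, ct, hct, hN⟩
  refine ⟨e.isConnected_iff.mpr hc, ⟨e.toEquiv j, by rwa [e.kind_eq]⟩, fun w => ct (e.toEquiv.symm w),
    ct_pos_of_graphIso e hct, ?_⟩
  rwa [ordersCt_eq_of_graphIso e ct]

end Orders

/-! ## §4 The sums over the families of (1.19)–(1.22), (2.15) regrouped by classes -/

section Families

variable {nbar V : ℕ} {M : Type*} [AddCommMonoid M]

/-- **Σ over the CONNECTED graphs** with `V` labelled vertices of an invariant `f` = Σ over the connected classes of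
`(V!/|Aut c|) • f c` (the graphs C_n of the perturbation expansion, pp. 414–416).
[cite: Balaban1983Higgs3, (1.19)–(1.21) p.416] -/
theorem finsum_connected_eq_finsum_classes (f : GraphOn nbar V → M)
    (hf : ∀ G H : GraphOn nbar V, Nonempty (GraphIso G.1 H.1) → f G = f H) :
    ∑ᶠ G : {G : GraphOn nbar V // IsConnected G.1}, f G.1 =
      ∑ᶠ c : {c : IsoClassOn nbar V // IsConnected c.out.1},
        (V.factorial / Nat.card (GraphIso c.1.out.1 c.1.out.1)) • f c.1.out :=
  finsum_subtype_graphOn_eq_finsum_classes (fun G => IsConnected G.1) (fun _ _ ⟨e⟩ => e.isConnected_iff.symm) f hf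

/-- **Σ over the ONE-PARTICLE-IRREDUCIBLE graphs** (the graphs of Σ^ε, Σ^ε_1, Σ^ε_2 in (1.21)) regrouped by classes.
[cite: Balaban1983Higgs3, (1.21) p.416] -/
theorem finsum_onePI_eq_finsum_classes (f : GraphOn nbar V → M)
    (hf : ∀ G H : GraphOn nbar V, Nonempty (GraphIso G.1 H.1) → f G = f H) :
    ∑ᶠ G : {G : GraphOn nbar V // IsOnePI G.1}, f G.1 =
      ∑ᶠ c : {c : IsoClassOn nbar V // IsOnePI c.out.1},
        (V.factorial / Nat.card (GraphIso c.1.out.1 c.1.out.1)) • f c.1.out :=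
  finsum_subtype_graphOn_eq_finsum_classes (fun G => IsOnePI G.1) (fun _ _ ⟨e⟩ => e.isOnePI_iff.symm) f hf

/-- **Σ over the PROPER graphs** (the graphs of (2.15), p. 428) regrouped by classes. [cite: Balaban1983Higgs3, (2.15) p.428] -/
theorem finsum_proper_eq_finsum_classes (f : GraphOn nbar V → M)
    (hf : ∀ G H : GraphOn nbar V, Nonempty (GraphIso G.1 H.1) → f G = f H) :
    ∑ᶠ G : {G : GraphOn nbar V // IsProper G.1}, f G.1 =
      ∑ᶠ c : {c : IsoClassOn nbar V // IsProper c.out.1},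
        (V.factorial / Nat.card (GraphIso c.1.out.1 c.1.out.1)) • f c.1.out :=
  finsum_subtype_graphOn_eq_finsum_classes (fun G => IsProper G.1) (fun _ _ ⟨e⟩ => e.isProper_iff.symm) f hf

/-- **Σ over the connected graphs OF GIVEN ORDERS (d_s, d_v) = o** (a fixed order e^{d_v}λ^{d_s} of the expansion, p. 420)
regrouped by classes. [cite: Balaban1983Higgs3, (1.19)–(1.21) p.416, p.420] -/
theorem finsum_connected_orders_eq_finsum_classes (o : ℕ × ℕ) (f : GraphOn nbar V → M)
    (hf : ∀ G H : GraphOn nbar V, Nonempty (GraphIso G.1 H.1) → f G = f H) :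
    ∑ᶠ G : {G : GraphOn nbar V // IsConnected G.1 ∧ orders G.1 = o}, f G.1 =
      ∑ᶠ c : {c : IsoClassOn nbar V // IsConnected c.out.1 ∧ orders c.out.1 = o},
        (V.factorial / Nat.card (GraphIso c.1.out.1 c.1.out.1)) • f c.1.out :=
  finsum_subtype_graphOn_eq_finsum_classes (fun G => IsConnected G.1 ∧ orders G.1 = o)
    (fun _ _ ⟨e⟩ => by rw [e.isConnected_iff, orders_eq_of_graphIso e]) f hf

/-- **Σ over the graphs with a given number of external legs** (e.g. the two-point graphs of (1.19)) regrouped by classes.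
[cite: Balaban1983Higgs3, (1.17) p.415, (1.19) p.416] -/
theorem finsum_numExtLegs_eq_finsum_classes (m : ℕ) (f : GraphOn nbar V → M)
    (hf : ∀ G H : GraphOn nbar V, Nonempty (GraphIso G.1 H.1) → f G = f H) :
    ∑ᶠ G : {G : GraphOn nbar V // G.1.numExtLegs = m}, f G.1 =
      ∑ᶠ c : {c : IsoClassOn nbar V // c.out.1.numExtLegs = m},
        (V.factorial / Nat.card (GraphIso c.1.out.1 c.1.out.1)) • f c.1.out :=
  finsum_subtype_graphOn_eq_finsum_classes (fun G => G.1.numExtLegs = m)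
    (fun _ _ ⟨e⟩ => by rw [e.numExtLegs_eq]) f hf

end Families

/-! ## §5 The same for the two-leg insertions (the letters and chains of (1.21)) -/

section TwoLeg

variable {nbar V : ℕ} {M : Type*}

/-- **Finitely many isomorphism classes of two-leg insertions on `V` vertices** — UNCONDITIONAL (FILE 2's
`finite_isoClassOnTL` with FILE 1's `finite_twoLeg_nV_eq`). [cite: Balaban1983Higgs3, (1.21) p.416] -/
instance finite_isoClassOnTL' (nbar V : ℕ) : Finite (IsoClassOnTL nbar V) :=
  finite_isoClassOnTL nbar V

/-- kernel: an isomorphism-invariant function on the labelled insertions is constant on the orbits of the relabelling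
action. [cite: Balaban1983Higgs3, (1.21) p.416] -/
theorem apply_smul_eq_of_iso_invariant_TL (f : TwoLegOn nbar V → M)
    (hf : ∀ T T' : TwoLegOn nbar V, Nonempty (TwoLegGraphIso T.1 T'.1) → f T = f T') (σ : Equiv.Perm (Fin V))
    (T : TwoLegOn nbar V) : f (σ • T) = f T :=
  hf _ _ (mem_orbit_iff_nonempty_twoLegGraphIso.mp (MulAction.mem_orbit T σ))

/-- kernel: conversely, constant on the orbits ⇒ an isomorphism invariant. [cite: Balaban1983Higgs3, (1.21) p.416] -/
theorem eq_of_smul_invariant_TL (f : TwoLegOn nbar V → M)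
    (hf : ∀ (σ : Equiv.Perm (Fin V)) (T : TwoLegOn nbar V), f (σ • T) = f T) {T T' : TwoLegOn nbar V}
    (e : TwoLegGraphIso T.1 T'.1) : f T = f T' := by
  obtain ⟨σ, hσ⟩ := MulAction.mem_orbit_iff.mp (mem_orbit_iff_nonempty_twoLegGraphIso.mpr ⟨e⟩)
  rw [← hσ, hf]

/-- kernel: an isomorphism-invariant `f` takes the same value on a labelled insertion and on the chosen representative of
its class. [cite: Balaban1983Higgs3, (1.21) p.416] -/
theorem apply_out_mk_eq_twoLegOn (f : TwoLegOn nbar V → M)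
    (hf : ∀ T T' : TwoLegOn nbar V, Nonempty (TwoLegGraphIso T.1 T'.1) → f T = f T') (T : TwoLegOn nbar V) :
    f (Quotient.mk (MulAction.orbitRel (Equiv.Perm (Fin V)) (TwoLegOn nbar V)) T : IsoClassOnTL nbar V).out = f T :=
  apply_out_mk_eq f (apply_smul_eq_of_iso_invariant_TL f hf) T

/-- **THE WEIGHTED CLASS FORMULA FOR THE TWO-LEG INSERTIONS**: for every isomorphism-invariant `f` on the insertions with
the `V` labelled vertices, `Σ_T f T = Σ_{classes c} (V!/|Aut c|) • f c` (FILE 2's `ncard_isoTL_mul_card_aut`; unconditional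
by FILE 1's `finite_twoLeg_nV_eq`). [cite: Balaban1983Higgs3, (1.21)–(1.22) p.416] -/
theorem finsum_twoLegOn_eq_finsum_classes [AddCommMonoid M] (f : TwoLegOn nbar V → M)
    (hf : ∀ T T' : TwoLegOn nbar V, Nonempty (TwoLegGraphIso T.1 T'.1) → f T = f T') :
    ∑ᶠ T : TwoLegOn nbar V, f T =
      ∑ᶠ c : IsoClassOnTL nbar V, (V.factorial / Nat.card (TwoLegGraphIso c.out.1 c.out.1)) • f c.out := by
  rw [finsum_eq_finsum_card_orbit_smul f (apply_smul_eq_of_iso_invariant_TL f hf)]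
  refine finsum_congr fun c => ?_
  rw [Nat.card_coe_set_eq, orbit_eq_setOf_isoTL, ncard_isoTL_eq_factorial_div]

/-- **The weighted class formula for a class function on insertions.** [cite: Balaban1983Higgs3, (1.21)–(1.22) p.416] -/
theorem finsum_twoLegOn_comp_mk [AddCommMonoid M] (g : IsoClassOnTL nbar V → M) :
    ∑ᶠ T : TwoLegOn nbar V, g (Quotient.mk (MulAction.orbitRel (Equiv.Perm (Fin V)) (TwoLegOn nbar V)) T) =
      ∑ᶠ c : IsoClassOnTL nbar V, (V.factorial / Nat.card (TwoLegGraphIso c.out.1 c.out.1)) • g c := by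
  rw [finsum_comp_mk_eq_finsum_card_orbit_smul]
  refine finsum_congr fun c => ?_
  rw [Nat.card_coe_set_eq, orbit_eq_setOf_isoTL, ncard_isoTL_eq_factorial_div]

/-- **The symmetry-factor identity for insertions** (field form): `Σ_c f(c)/|Aut c| = (1/V!) Σ_T f(T)`.
[cite: Balaban1983Higgs3, (1.21)–(1.22) p.416] -/
theorem finsum_classesTL_div_card_aut {K : Type*} [Field K] [CharZero K] (f : TwoLegOn nbar V → K)
    (hf : ∀ T T' : TwoLegOn nbar V, Nonempty (TwoLegGraphIso T.1 T'.1) → f T = f T') :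
    ∑ᶠ c : IsoClassOnTL nbar V, f c.out / (Nat.card (TwoLegGraphIso c.out.1 c.out.1) : K) =
      (∑ᶠ T : TwoLegOn nbar V, f T) / (V.factorial : K) := by
  classical
  haveI : Fintype (IsoClassOnTL nbar V) := Fintype.ofFinite _
  rw [finsum_twoLegOn_eq_finsum_classes f hf, finsum_eq_sum_of_fintype, finsum_eq_sum_of_fintype, Finset.sum_div]
  refine Finset.sum_congr rfl fun c _ => ?_
  have ha : (Nat.card (TwoLegGraphIso c.out.1 c.out.1) : K) ≠ 0 :=
    Nat.cast_ne_zero.mpr (card_twoLegGraphIso_self_pos c.out.1).ne'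
  have hV : (V.factorial : K) ≠ 0 := Nat.cast_ne_zero.mpr (Nat.factorial_ne_zero V)
  have hdvd : Nat.card (TwoLegGraphIso c.out.1 c.out.1) ∣ V.factorial := by
    have h := card_autTL_dvd_factorial c.out.1
    rwa [c.out.2] at h
  rw [nsmul_eq_mul, Nat.cast_div_charZero hdvd]
  field_simp

/-- **The weighted class formula for insertions restricted to an isomorphism-closed family**, cut-off form.
[cite: Balaban1983Higgs3, (1.21)–(1.22) p.416] -/
theorem finsum_twoLegOn_ite_eq_finsum_classes [AddCommMonoid M] (P : TwoLegOn nbar V → Prop) [DecidablePred P]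
    (hP : ∀ T T' : TwoLegOn nbar V, Nonempty (TwoLegGraphIso T.1 T'.1) → (P T ↔ P T')) (f : TwoLegOn nbar V → M)
    (hf : ∀ T T' : TwoLegOn nbar V, Nonempty (TwoLegGraphIso T.1 T'.1) → f T = f T') :
    ∑ᶠ T : TwoLegOn nbar V, (if P T then f T else 0) =
      ∑ᶠ c : IsoClassOnTL nbar V,
        if P c.out then (V.factorial / Nat.card (TwoLegGraphIso c.out.1 c.out.1)) • f c.out else 0 := by
  rw [finsum_twoLegOn_eq_finsum_classes (fun T => if P T then f T else 0) fun T T' h => by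
    by_cases hT : P T
    · rw [if_pos hT, if_pos ((hP T T' h).mp hT), hf T T' h]
    · rw [if_neg hT, if_neg (mt (hP T T' h).mpr hT)]]
  exact finsum_congr fun c => by split_ifs <;> simp

/-- **The weighted class formula for insertions restricted to an isomorphism-closed family**, subtype form.
[cite: Balaban1983Higgs3, (1.21)–(1.22) p.416] -/
theorem finsum_subtype_twoLegOn_eq_finsum_classes [AddCommMonoid M] (P : TwoLegOn nbar V → Prop)
    (hP : ∀ T T' : TwoLegOn nbar V, Nonempty (TwoLegGraphIso T.1 T'.1) → (P T ↔ P T')) (f : TwoLegOn nbar V → M)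
    (hf : ∀ T T' : TwoLegOn nbar V, Nonempty (TwoLegGraphIso T.1 T'.1) → f T = f T') :
    ∑ᶠ T : {T : TwoLegOn nbar V // P T}, f T.1 =
      ∑ᶠ c : {c : IsoClassOnTL nbar V // P c.out},
        (V.factorial / Nat.card (TwoLegGraphIso c.1.out.1 c.1.out.1)) • f c.1.out := by
  classical
  calc ∑ᶠ T : {T : TwoLegOn nbar V // P T}, f T.1
      = ∑ᶠ T : TwoLegOn nbar V, (if P T then f T else 0) := finsum_subtype_eq_finsum_ite P f
    _ = ∑ᶠ c : IsoClassOnTL nbar V,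
          if P c.out then (V.factorial / Nat.card (TwoLegGraphIso c.out.1 c.out.1)) • f c.out else 0 :=
        finsum_twoLegOn_ite_eq_finsum_classes P hP f hf
    _ = ∑ᶠ c : {c : IsoClassOnTL nbar V // P c.out},
          (V.factorial / Nat.card (TwoLegGraphIso c.1.out.1 c.1.out.1)) • f c.1.out :=
        (finsum_subtype_eq_finsum_ite (fun c : IsoClassOnTL nbar V => P c.out)
          (fun c => (V.factorial / Nat.card (TwoLegGraphIso c.out.1 c.out.1)) • f c.out)).symm

/-- **Σ over the ONE-PARTICLE-IRREDUCIBLE insertions** (the letters Σ^ε, Σ^ε_1, Σ^ε_2 of (1.21) read as two-leg insertions)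
regrouped by classes. [cite: Balaban1983Higgs3, (1.21) p.416] -/
theorem finsum_onePI_TL_eq_finsum_classes [AddCommMonoid M] (f : TwoLegOn nbar V → M)
    (hf : ∀ T T' : TwoLegOn nbar V, Nonempty (TwoLegGraphIso T.1 T'.1) → f T = f T') :
    ∑ᶠ T : {T : TwoLegOn nbar V // IsOnePI T.1.G}, f T.1 =
      ∑ᶠ c : {c : IsoClassOnTL nbar V // IsOnePI c.out.1.G},
        (V.factorial / Nat.card (TwoLegGraphIso c.1.out.1 c.1.out.1)) • f c.1.out :=
  finsum_subtype_twoLegOn_eq_finsum_classes (fun T => IsOnePI T.1.G) (fun _ _ ⟨e⟩ => e.isOnePI_iff.symm) f hf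

/-- **Σ over the CONNECTED insertions** (the chains of (1.21)) regrouped by classes. [cite: Balaban1983Higgs3, (1.21) p.416] -/
theorem finsum_connected_TL_eq_finsum_classes [AddCommMonoid M] (f : TwoLegOn nbar V → M)
    (hf : ∀ T T' : TwoLegOn nbar V, Nonempty (TwoLegGraphIso T.1 T'.1) → f T = f T') :
    ∑ᶠ T : {T : TwoLegOn nbar V // IsConnected T.1.G}, f T.1 =
      ∑ᶠ c : {c : IsoClassOnTL nbar V // IsConnected c.out.1.G},
        (V.factorial / Nat.card (TwoLegGraphIso c.1.out.1 c.1.out.1)) • f c.1.out :=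
  finsum_subtype_twoLegOn_eq_finsum_classes (fun T => IsConnected T.1.G) (fun _ _ ⟨e⟩ => e.isConnected_iff.symm)
    f hf

end TwoLeg

/-! ## §6 Unconditional counts; bounded coupling order -/

section Counts

variable {nbar : ℕ}

/-- **CLASS FORMULA, unconditional**: the number of graphs of the model on the `V` labelled vertices is the sum over the
isomorphism classes of `V!/|Aut c|` (FILE 2's `card_graphOn_eq_finsum_classes`, its finiteness hypothesis discharged by
FILE 1). [cite: Balaban1983Higgs3, p.415, (1.21)–(1.22) p.416] -/
theorem card_graphOn_eq_finsum_classes' (nbar V : ℕ) :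
    Nat.card (GraphOn nbar V) = ∑ᶠ c : IsoClassOn nbar V, V.factorial / Nat.card (GraphIso c.out.1 c.out.1) :=
  card_graphOn_eq_finsum_classes nbar V

/-- **BURNSIDE'S COUNT, unconditional**: `#classes · V! = Σ_σ #{labelled graphs fixed by σ}`.
[cite: Balaban1983Higgs3, p.415, (1.21)–(1.22) p.416] -/
theorem card_isoClassOn_mul_factorial' (nbar V : ℕ) :
    Nat.card (IsoClassOn nbar V) * V.factorial =
      ∑ σ : Equiv.Perm (Fin V), Nat.card (MulAction.fixedBy (GraphOn nbar V) σ) :=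
  card_isoClassOn_mul_factorial nbar V

/-- kernel: the number of classes on `V` vertices is at most the number of labelled graphs on `V` vertices.
[cite: Balaban1983Higgs3, p.415] -/
theorem card_isoClassOn_le (nbar V : ℕ) : Nat.card (IsoClassOn nbar V) ≤ Nat.card (GraphOn nbar V) :=
  Nat.card_le_card_of_surjective _ Quotient.mk_surjective

/-- **CLASS FORMULA for the two-leg insertions, unconditional.** [cite: Balaban1983Higgs3, (1.21)–(1.22) p.416] -/
theorem card_twoLegOn_eq_finsum_classes' (nbar V : ℕ) :
    Nat.card (TwoLegOn nbar V) = ∑ᶠ c : IsoClassOnTL nbar V, V.factorial / Nat.card (TwoLegGraphIso c.out.1 c.out.1) :=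
  card_twoLegOn_eq_finsum_classes nbar V

/-- **BURNSIDE'S COUNT for the two-leg insertions, unconditional.** [cite: Balaban1983Higgs3, (1.21)–(1.22) p.416] -/
theorem card_isoClassOnTL_mul_factorial' (nbar V : ℕ) :
    Nat.card (IsoClassOnTL nbar V) * V.factorial =
      ∑ σ : Equiv.Perm (Fin V), Nat.card (MulAction.fixedBy (TwoLegOn nbar V) σ) :=
  card_isoClassOnTL_mul_factorial nbar V

/-- **AT A FIXED COUPLING ORDER ONLY BOUNDEDLY MANY VERTEX NUMBERS OCCUR**: no connected graph of the family of total order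
`≤ N` (FILE 1's provisos) lives on `V > (n̄ + 5)·N` labelled vertices — so the class-regrouped sums of `§4` at order
`≤ N` are carried by finitely many `(V, c)`. [cite: Balaban1983Higgs3, (1.17) p.415, p.420] -/
theorem not_exists_connected_of_lt {N V : ℕ} (hV : (nbar + 5) * N < V) :
    ¬ ∃ G : GraphOn nbar V, IsConnected G.1 ∧ (∃ j, G.1.kind j ≠ .v113) ∧ ∃ ct : Fin G.1.nV → ℕ × ℕ,
      (∀ i, G.1.kind i = .v17 → 1 ≤ (ct i).1 + (ct i).2) ∧ (ordersCt G.1 ct).1 + (ordersCt G.1 ct).2 ≤ N := by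
  rintro ⟨G, hc, hne, ct, hct, hN⟩
  have h := nV_le_of_isConnected G.1 hc hne ct hct
  rw [G.2] at h
  exact absurd (h.trans (Nat.mul_le_mul_left _ hN)) (not_le.mpr hV)

/-- kernel: hence the vertex numbers `V` carrying a connected graph of total order `≤ N` form a finite set (inside
`{0, …, (n̄+5)·N}`). [cite: Balaban1983Higgs3, (1.17) p.415, p.420] -/
theorem finite_setOf_nV_connected_order_le (nbar N : ℕ) :
    Set.Finite {V : ℕ | ∃ G : GraphOn nbar V, IsConnected G.1 ∧ (∃ j, G.1.kind j ≠ .v113) ∧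
      ∃ ct : Fin G.1.nV → ℕ × ℕ, (∀ i, G.1.kind i = .v17 → 1 ≤ (ct i).1 + (ct i).2) ∧
        (ordersCt G.1 ct).1 + (ordersCt G.1 ct).2 ≤ N} :=
  (Set.finite_Iic ((nbar + 5) * N)).subset fun _ hV =>
    not_lt.mp fun h => not_exists_connected_of_lt (nbar := nbar) h hV

/-- kernel: the classes on `V` vertices of connected graphs of total order `≤ N` — a well-defined family of classes by
`connectedOrderLe_iff_of_graphIso` — are EMPTY for `V > (n̄ + 5)·N`. [cite: Balaban1983Higgs3, (1.17) p.415, p.420] -/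
theorem isEmpty_classes_connected_of_lt {N V : ℕ} (hV : (nbar + 5) * N < V) :
    IsEmpty {c : IsoClassOn nbar V // IsConnected c.out.1 ∧ (∃ j, c.out.1.kind j ≠ .v113) ∧
      ∃ ct : Fin c.out.1.nV → ℕ × ℕ, (∀ i, c.out.1.kind i = .v17 → 1 ≤ (ct i).1 + (ct i).2) ∧
        (ordersCt c.out.1 ct).1 + (ordersCt c.out.1 ct).2 ≤ N} :=
  ⟨fun c => not_exists_connected_of_lt hV ⟨c.1.out, c.2⟩⟩

end Counts

end Literature.MathematicalPhysics.QuantumFieldTheory.Balaban1983to89.B3GraphClassCount
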